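import Mathlib
import Summits.CriticalPhenomena.CardyFormulaZ2.Theorems.CardySelfRefinementDefs
import Summits.CriticalPhenomena.CardyFormulaZ2.Theorems.CardySelfRefinementTrivialSectorRateStubFourArmAboveOneTwoArmsLocality
import Summits.CriticalPhenomena.CardyFormulaZ2.Theorems.CardySelfRefinementTrivialSectorRateStubFourArmAboveOneCircuits
import Literature.Probability.Percolation.FourArmGarbanTwoArms
import HarnessLib

/-!
# Helper `openDualArmsAt_decay_along` (M3) of stub `stub_fourArmAboveOne`, line
`far-field-is-a-quarter-turn` (crux `TrivialSectorRate`, stmt-CriticalPhenomena-10266):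
polynomial decay of Garban's two-arm revealment event for `M_k(γ s)`, uniformly along the path

**(M3)** Along an admissible RSW path `γ` (`PathOK k γ`, `k = 2, 3`) there are `c', a > 0` and
`m₀` with `M_k(γ s)(openDualArmsAt c m n) ≤ c' (m/n)^a` for all `s`, every centre `c` and all radii
`m₀ ≤ m ≤ n` (`openDualArmsAt_decay_along`, registered helper; this is hypothesis `h₂` of the
percolation-free reduction `fourArmAboveOneAlong_of_garbanScheme`,
file `…StubFourArmAboveOneReduction.lean`).

Proof (Schramm–Smirnov 2011, App. B, (B.6) "by the RSW theory, `P[Y_j] ≲ (r/R)^{2ε}`", run for the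
dependent model `M_k` through its coin product structure): the open arm crosses `J ≍ log₄(n/m)`
disjoint `k`-separated geometric annuli `(c-1) + A_{4ⁱm, 2·4ⁱm}`; no annulus may carry a closed dual
circuit, these events are independent under `M_k` and each has probability `≤ 1 - ρ₄` by the
thin-annulus circuit bound (M1) (`circuitsAlong` at aspect ratio `K = 4`), so the probability is
`≤ q^J`, `q = max(1 - ρ₄, 1/4)` (`real_openDualArmsAt_le_pow`, file `…TwoArmsLocality.lean`), and
`q^J = ((1/4)^J)^a ≤ (2m/n)^a` with `a = log_{1/4} q > 0` since `n ≤ 2·4^J m`.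

References: O. Schramm, S. Smirnov (app. C. Garban), Ann. Probab. 39 (2011), App. B, (B.6);
J. van den Berg, P. Nolin, Progr. Probab. 77 (2020), §5.2; G. Grimmett, *Percolation* (1999),
§11.7 (11.78).

Target file:
`Summits/CriticalPhenomena/CardyFormulaZ2/Theorems/CardySelfRefinementTrivialSectorRateStubFourArmAboveOneTwoArms.lean`.
-/

noncomputable section

namespace Summit.CriticalPhenomena.CardyFormulaZ2.Theorems.CardySelfRefinement.FarField

open Set MeasureTheory
open Literature.Probability.LatticeModels Literature.Probability.Percolation
open Literature.Probability.Percolation.QuadCrossing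
open Summit.CriticalPhenomena.CardyFormulaZ2.Theses.CardySelfRefinement

/-! ### The helper (M3) -/

/-- **(M3) Polynomial decay of the two-arm revealment event along an RSW path** (registered helper
of the stub `stub_fourArmAboveOne`; hypothesis `h₂` of `fourArmAboveOneAlong_of_garbanScheme`).
For `PathOK k γ`, `k = 2, 3`, there are `c', a > 0` and `m₀` such that
`M_k(γ s)(openDualArmsAt c m n) ≤ c' (m/n)^a` for all `s`, `c` and `m₀ ≤ m ≤ n`: the open arm
crosses `J ≍ log₄(n/m)` disjoint `k`-separated geometric annuli, in each of which (M1)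
(`circuitsAlong`, aspect ratio `4`) puts a closed dual circuit with probability `≥ ρ₄` independently
of the others (coin product structure of `M_k`), whence the bound `(1 - ρ₄)^J ≤ 2^a (m/n)^a` with
`a = log_{1/4} max(1 - ρ₄, 1/4)` (Schramm–Smirnov 2011, App. B, (B.6), for the dependent model). -/
theorem openDualArmsAt_decay_along {k : ℕ} (hk : k = 2 ∨ k = 3) {γ : unitInterval → ℝ × ℝ}
    (hγ : PathOK k γ) :
    ∃ c' a : ℝ, 0 < c' ∧ 0 < a ∧ ∃ m₀ : ℕ, ∀ (s : unitInterval) (c : Site 2) (m n : ℕ),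
      m₀ ≤ m → m ≤ n →
        (M k (γ s).1 (γ s).2).real (openDualArmsAt c m n) ≤ c' * ((m : ℝ) / n) ^ a := by
  have hk0 : 0 < k := by rcases hk with rfl | rfl <;> norm_num
  have hk3 : k ≤ 3 := by rcases hk with rfl | rfl <;> norm_num
  obtain ⟨ρs, hρs, a₀, hcirc⟩ := circuitsAlong hk hγ (K := 4) (by norm_num)
  -- the decay rate
  set q : ℝ := max (1 - ρs) (1 / 4) with hq
  have hq0 : 0 < q := lt_of_lt_of_le (by norm_num) (le_max_right _ _)
  have hq1 : q < 1 := max_lt (by linarith) (by norm_num)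
  have h14 : (0 : ℝ) ≤ 1 / 4 := by norm_num
  set α : ℝ := Real.logb (1 / 4) q with hα
  have hα0 : 0 < α := Real.logb_pos_of_base_lt_one (by norm_num) (by norm_num) hq0 hq1
  have hqα : (1 / 4 : ℝ) ^ α = q := Real.rpow_logb (by norm_num) (by norm_num) hq0
  refine ⟨(2 : ℝ) ^ α, α, by positivity, hα0, max a₀ 2, fun s c m n hm hmn => ?_⟩
  have hm0 : a₀ ≤ m := (le_max_left _ _).trans hm
  have hm2 : 2 ≤ m := (le_max_right _ _).trans hm
  -- the number `J` of geometric annuli between `m` and `n - 1`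
  obtain ⟨J, hJ1, hJ2⟩ : ∃ J : ℕ, (∀ i < J, 2 * (4 ^ i * m) + 1 ≤ n) ∧ n ≤ 2 * (4 ^ J * m) := by
    refine ⟨Nat.clog 4 ((n - 1) / (2 * m) + 1), fun i hi => ?_, ?_⟩
    · have h4 : 4 ^ i < (n - 1) / (2 * m) + 1 := (Nat.lt_clog_iff_pow_lt (by norm_num)).1 hi
      have h5 : 4 ^ i * (2 * m) ≤ (n - 1) / (2 * m) * (2 * m) :=
        Nat.mul_le_mul_right (2 * m) (Nat.lt_succ_iff.1 h4)
      have h6 : (n - 1) / (2 * m) * (2 * m) ≤ n - 1 := Nat.div_mul_le_self _ _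
      have e1 : 4 ^ i * (2 * m) = 2 * (4 ^ i * m) := by ring
      omega
    · have h4 : (n - 1) / (2 * m) + 1 ≤ 4 ^ Nat.clog 4 ((n - 1) / (2 * m) + 1) :=
        Nat.le_pow_clog (by norm_num) _
      have h5 : n - 1 < (n - 1) / (2 * m) * (2 * m) + 2 * m := Nat.lt_div_mul_add (by omega)
      have h6 : ((n - 1) / (2 * m) + 1) * (2 * m) ≤
          4 ^ Nat.clog 4 ((n - 1) / (2 * m) + 1) * (2 * m) := Nat.mul_le_mul_right (2 * m) h4
      have e2 : ((n - 1) / (2 * m) + 1) * (2 * m) = (n - 1) / (2 * m) * (2 * m) + 2 * m := by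
        ring
      have e3 : 4 ^ Nat.clog 4 ((n - 1) / (2 * m) + 1) * (2 * m) =
          2 * (4 ^ Nat.clog 4 ((n - 1) / (2 * m) + 1) * m) := by ring
      omega
  -- the probability bound `q ^ J`
  have hP : (M k (γ s).1 (γ s).2).real (openDualArmsAt c m n) ≤ q ^ J :=
    real_openDualArmsAt_le_pow hk0 hk3 (γ s).1 (γ s).2 (q := q) (a₀ := a₀)
      (fun c' a b h1 h2 h3 => by
        have := (hcirc s c' a b h1 h2 h3).2
        linarith [le_max_left (1 - ρs) (1 / 4 : ℝ)])
      c hm0 hm2 hJ1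
  -- arithmetic: `q ^ J = ((1/4)^J)^α ≤ (2 m / n)^α`
  have hn0 : (0 : ℝ) < n := by exact_mod_cast (show 0 < n by omega)
  have h4J : (0 : ℝ) < (4 : ℝ) ^ J := by positivity
  have hratio : ((1 : ℝ) / 4) ^ J ≤ 2 * ((m : ℝ) / n) := by
    rw [one_div_pow, div_le_iff₀ h4J,
      show 2 * ((m : ℝ) / n) * 4 ^ J = 2 * (4 ^ J * m) / n by ring, le_div_iff₀ hn0, one_mul]
    exact_mod_cast hJ2
  calc (M k (γ s).1 (γ s).2).real (openDualArmsAt c m n) ≤ q ^ J := hP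
    _ = (((1 : ℝ) / 4) ^ J) ^ α := by rw [← hqα, Real.rpow_pow_comm h14]
    _ ≤ (2 * ((m : ℝ) / n)) ^ α := Real.rpow_le_rpow (by positivity) hratio hα0.le
    _ = (2 : ℝ) ^ α * ((m : ℝ) / n) ^ α := Real.mul_rpow (by norm_num) (by positivity)

end Summit.CriticalPhenomena.CardyFormulaZ2.Theorems.CardySelfRefinement.FarField

end
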